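import Mathlib
import Literature.Analysis.FunctionSpaces.TorusDerivSizeBounds
import Literature.Analysis.FluidPDE.HardSpherePhaseSpaceProofs
import Summits.AtomisticToContinuum.HydrodynamicLimit.Theorems.RelayRaceLocalityNearConstantShortTimeHLTorusLipschitz
import HarnessLib

/-!
# RelayRaceLocality · ConeLocalisation — stub `stub_flatteningDensity`, part B: scale-`r` bounds of a
# cut-off product on `𝕋³`

Support file for the crux item `stmt-AtomisticToContinuum-12504` (`ConeLocalisation`, route RelayRaceLocality of
`AtomisticToContinuum/HydrodynamicLimit`), line `zoomed-bubble-transplant`, stub `stub_flatteningDensity`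
(`FlatteningDensity`, `Theorems/RelayRaceLocalityConeLocalisationLocalDefs.lean`). The flattened activity
`A = ψ·Φ(ρ₁σ³) + (1 - ψ)·Φ(ρ₁(c)σ³)` differs from a constant by the cut-off product `ψ·g`,
`g = Φ(ρ₁σ³) - Φ(ρ₁(c)σ³)`, where the cut-off `ψ ∈ [0, 1]` vanishes off `B(c, 2r)` and has `|∂ᵏψ| ≤ C_ψ r^{-k}`,
while `g` is smooth with `g(c) = 0` and `|∂ᵏg| ≤ L` (`k ≤ 3`). This file proves the scale-`r` bounds
`|ψ g| ≤ 6 L r`, `|∂(ψg)| ≤ (1 + 12C_ψ) L`, `|∂²(ψg)| ≤ (1 + 12C_ψ) L / r`, `|∂³(ψg)| ≤ (1 + 12C_ψ) L / r²`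
(`flatDen_cutoff_product_bounds`) from the ABSTRACT cut-off hypotheses of `FlatteningDensity` alone: inside the
ball, pointwise Leibniz bounds (`Torus.abs_partialDeriv_mul_le₁/₂/₃`) with the Lipschitz estimate
`|g x| ≤ 3L·dist(x, c) ≤ 6 L r` (`abs_sub_le_of_partialDeriv_le`, `Torus.norm_sub_le_euclidDist`); on the closure
of the ball by continuity of the derivatives; off the closure all derivatives of `ψ g` vanish by locality of
`Torus.partialDeriv` (`flatDen_partialDeriv_eq_zero_of_eventually`).
-/

noncomputable section

namespace Summit.AtomisticToContinuum.HydrodynamicLimit.Theorems.ConeLocalisation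

open scoped Topology ContDiff
open Filter Set
open Literature.MathematicalPhysics.KineticTheory Literature.Analysis.FluidPDE
  Literature.Analysis.FunctionSpaces

/-! ### Locality of torus partial derivatives (real-valued functions on `𝕋³`) -/

-- adapted from `Literature.Analysis.FunctionSpaces.Torus.partialDeriv_eq_zero_of_eventuallyEq_const`
-- (TorusCutoffSymbols, stated there over `ℂ`-normed targets)
/-- A function vanishing near `x` has `∂_j = 0` at `x`. [folklore] -/
theorem flatDen_partialDeriv_eq_zero_of_eventually {f : T3 → ℝ} {x : T3} (h : ∀ᶠ y in 𝓝 x, f y = 0)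
    (j : Fin 3) : Torus.partialDeriv j f x = 0 := by
  unfold Torus.partialDeriv Torus.lineDeriv
  have hc : Tendsto (fun t : ℝ => x + Torus.proj (t • EuclideanSpace.single j (1 : ℝ))) (𝓝 0) (𝓝 x) := by
    have : Continuous fun t : ℝ => x + Torus.proj (t • EuclideanSpace.single j (1 : ℝ)) :=
      continuous_const.add (Torus.continuous_proj.comp (continuous_id.smul continuous_const))
    have h0 := this.continuousAt (x := 0)
    rwa [ContinuousAt, zero_smul, Torus.proj_zero, add_zero] at h0
  have hev : (fun t : ℝ => f (x + Torus.proj (t • EuclideanSpace.single j (1 : ℝ)))) =ᶠ[𝓝 0]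
      fun _ => (0 : ℝ) := hc.eventually h
  rw [hev.deriv_eq]
  simp

/-- A function vanishing on an open set has vanishing partial derivatives of orders `1, 2, 3` there.
[folklore] -/
theorem flatDen_partialDerivs_eq_zero_of_eqOn {f : T3 → ℝ} {O : Set T3} (hO : IsOpen O)
    (hf : ∀ y ∈ O, f y = 0) (x : T3) (hx : x ∈ O) (i j k : Fin 3) :
    Torus.partialDeriv i f x = 0 ∧ Torus.partialDeriv i (Torus.partialDeriv j f) x = 0 ∧
      Torus.partialDeriv i (Torus.partialDeriv j (Torus.partialDeriv k f)) x = 0 := by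
  have step : ∀ {g : T3 → ℝ}, (∀ y ∈ O, g y = 0) → ∀ l, ∀ y ∈ O, Torus.partialDeriv l g y = 0 :=
    fun hg l y hy => flatDen_partialDeriv_eq_zero_of_eventually
      (by filter_upwards [hO.mem_nhds hy] with z hz; exact hg z hz) l
  exact ⟨step hf i x hx, step (step hf j) i x hx, step (step (step hf k) j) i x hx⟩

/-- A continuous function bounded by `K ≥ 0` on `U` and vanishing off the closure of `U` is bounded by `K`
everywhere. [folklore] -/
theorem flatDen_abs_le_of_closure {g : T3 → ℝ} (hg : Continuous g) {U : Set T3} {K : ℝ} (hK : 0 ≤ K)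
    (hU : ∀ x ∈ U, |g x| ≤ K) (hout : ∀ x, x ∉ closure U → g x = 0) (x : T3) : |g x| ≤ K := by
  by_cases hx : x ∈ closure U
  · have hcl : IsClosed {y | |g y| ≤ K} := isClosed_le (continuous_abs.comp hg) continuous_const
    exact closure_minimal (fun y hy => hU y hy) hcl hx
  · rw [hout x hx, abs_zero]; exact hK

/-! ### The cut-off product bounds -/

/-- **Scale-`r` bounds of a cut-off product on `𝕋³`.** Let `0 < r ≤ 1`, `ψ` a smooth cut-off with values in
`[0, 1]`, vanishing where `2r ≤ dist(x, c)` (minimal-image distance), with `|∂ψ| ≤ C_ψ/r`, `|∂²ψ| ≤ C_ψ/r²`,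
`|∂³ψ| ≤ C_ψ/r³`, and `g` smooth with `g(c) = 0` and all derivatives of orders `1, 2, 3` bounded by `L`. Then
`|ψ g| ≤ 6 L r`, `|∂(ψ g)| ≤ (1 + 12 C_ψ) L`, `|∂²(ψ g)| ≤ (1 + 12 C_ψ) L / r`, `|∂³(ψ g)| ≤ (1 + 12 C_ψ) L / r²`
everywhere. [folklore] -/
theorem flatDen_cutoff_product_bounds : ∀ {ψ g : T3 → ℝ} {c : T3} {r Cψ L : ℝ}, 0 < r → r ≤ 1 →
    0 ≤ Cψ → 0 ≤ L → Torus.IsSmooth ψ → (∀ x, 0 ≤ ψ x ∧ ψ x ≤ 1) →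
    (∀ x, 2 * r ≤ Torus.euclidDist x c → ψ x = 0) →
    (∀ x, ∀ i j k : Fin 3, |Torus.partialDeriv i ψ x| ≤ Cψ / r ∧
      |Torus.partialDeriv i (Torus.partialDeriv j ψ) x| ≤ Cψ / r ^ 2 ∧
      |Torus.partialDeriv i (Torus.partialDeriv j (Torus.partialDeriv k ψ)) x| ≤ Cψ / r ^ 3) →
    Torus.IsSmooth g → g c = 0 →
    (∀ x, ∀ i j k : Fin 3, |Torus.partialDeriv i g x| ≤ L ∧
      |Torus.partialDeriv i (Torus.partialDeriv j g) x| ≤ L ∧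
      |Torus.partialDeriv i (Torus.partialDeriv j (Torus.partialDeriv k g)) x| ≤ L) →
    (∀ x, |ψ x * g x| ≤ 6 * L * r) ∧
    ∀ x, ∀ i j k : Fin 3, |Torus.partialDeriv i (fun y => ψ y * g y) x| ≤ (1 + 12 * Cψ) * L ∧
      |Torus.partialDeriv i (Torus.partialDeriv j (fun y => ψ y * g y)) x| ≤ (1 + 12 * Cψ) * L / r ∧
      |Torus.partialDeriv i (Torus.partialDeriv j (Torus.partialDeriv k (fun y => ψ y * g y))) x| ≤
        (1 + 12 * Cψ) * L / r ^ 2 := by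
  intro ψ g c r Cψ L hr hr1 hCψ hL hψ hψ01 hψ0 hψd hg hgc hgd
  have hr0 : r ≠ 0 := hr.ne'
  -- Lipschitz estimate of `g` from the centre
  have hlip : ∀ x, |g x| ≤ 3 * L * Torus.euclidDist x c := by
    intro x
    have h := NearConstantShortTimeHL.abs_sub_le_of_partialDeriv_le hg (fun i y => (hgd y i i i).1) x c
    rw [hgc, sub_zero] at h
    refine h.trans (mul_le_mul_of_nonneg_left ?_ (by positivity))
    rw [dist_eq_norm]; exact Torus.norm_sub_le_euclidDist_holds x c
  set U : Set T3 := {x | Torus.euclidDist x c < 2 * r} with hU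
  have hgU : ∀ x ∈ U, |g x| ≤ 6 * L * r := fun x hx => by
    have hx' : Torus.euclidDist x c < 2 * r := hx
    calc |g x| ≤ 3 * L * Torus.euclidDist x c := hlip x
      _ ≤ 3 * L * (2 * r) := mul_le_mul_of_nonneg_left hx'.le (by positivity)
      _ = 6 * L * r := by ring
  have hψU : ∀ x, x ∉ U → ψ x = 0 := fun x hx => hψ0 x (not_lt.1 hx)
  have hψ0' : ∀ x, |ψ x| ≤ 1 := fun x => by rw [abs_of_nonneg (hψ01 x).1]; exact (hψ01 x).2
  -- order zero
  have h0 : ∀ x, |ψ x * g x| ≤ 6 * L * r := by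
    intro x
    by_cases hx : x ∈ U
    · rw [abs_mul]
      calc |ψ x| * |g x| ≤ 1 * (6 * L * r) := mul_le_mul (hψ0' x) (hgU x hx) (abs_nonneg _) zero_le_one
        _ = 6 * L * r := one_mul _
    · rw [hψU x hx, zero_mul, abs_zero]; positivity
  refine ⟨h0, ?_⟩
  -- the product vanishes, with all its derivatives, on the open complement of the closure of the ball
  set P : T3 → ℝ := fun y => ψ y * g y with hP
  have hPs : Torus.IsSmooth P := (ContDiff.mul hψ hg : Torus.IsSmooth fun y => ψ y * g y)
  have hO : IsOpen (closure U)ᶜ := isClosed_closure.isOpen_compl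
  have hPO : ∀ y ∈ (closure U)ᶜ, P y = 0 := fun y hy => by
    have hyU : y ∉ U := fun h => hy (subset_closure h)
    simp only [hP, hψU y hyU, zero_mul]
  have hzero := fun x (hx : x ∉ closure U) (i j k : Fin 3) =>
    flatDen_partialDerivs_eq_zero_of_eqOn hO hPO x hx i j k
  -- pointwise Leibniz bounds inside the ball
  have h1r : 1 ≤ 1 / r := by rw [le_div_iff₀ hr]; linarith
  have hr2 : 0 < r ^ 2 := by positivity
  have h1r2 : 1 / r ≤ 1 / r ^ 2 := by rw [div_le_div_iff₀ hr hr2]; nlinarith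
  have hL1 : L ≤ L * (1 / r) := by nlinarith
  have hL2 : L ≤ L * (1 / r ^ 2) := by nlinarith
  have hm0 : 0 ≤ Cψ * L * (1 / r) := by positivity
  have hm2 : Cψ * L * (1 / r) ≤ Cψ * L * (1 / r ^ 2) := mul_le_mul_of_nonneg_left h1r2 (by positivity)
  have hin : ∀ x ∈ U, ∀ i j k : Fin 3, |Torus.partialDeriv i P x| ≤ (1 + 12 * Cψ) * L ∧
      |Torus.partialDeriv i (Torus.partialDeriv j P) x| ≤ (1 + 12 * Cψ) * L / r ∧
      |Torus.partialDeriv i (Torus.partialDeriv j (Torus.partialDeriv k P)) x| ≤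
        (1 + 12 * Cψ) * L / r ^ 2 := by
    intro x hx i j k
    have hf₁ : ∀ i, |Torus.partialDeriv i ψ x| ≤ Cψ / r := fun i => (hψd x i i i).1
    have hf₂ : ∀ i j, |Torus.partialDeriv j (Torus.partialDeriv i ψ) x| ≤ Cψ / r ^ 2 :=
      fun i j => (hψd x j i i).2.1
    have hf₃ : ∀ i j k, |Torus.partialDeriv k (Torus.partialDeriv j (Torus.partialDeriv i ψ)) x| ≤
        Cψ / r ^ 3 := fun i j k => (hψd x k j i).2.2
    have hg₁ : ∀ i, |Torus.partialDeriv i g x| ≤ L := fun i => (hgd x i i i).1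
    have hg₂ : ∀ i j, |Torus.partialDeriv j (Torus.partialDeriv i g) x| ≤ L := fun i j => (hgd x j i i).2.1
    have hg₃ : ∀ i j k, |Torus.partialDeriv k (Torus.partialDeriv j (Torus.partialDeriv i g)) x| ≤ L :=
      fun i j k => (hgd x k j i).2.2
    have e1 := Torus.abs_partialDeriv_mul_le₁ hψ hg (hψ0' x) hf₁ (hgU x hx) hg₁ i
    have e2 := Torus.abs_partialDeriv_mul_le₂ hψ hg (hψ0' x) hf₁ hf₂ (hgU x hx) hg₁ hg₂ j i
    have e3 := Torus.abs_partialDeriv_mul_le₃ hψ hg (hψ0' x) hf₁ hf₂ hf₃ (hgU x hx) hg₁ hg₂ hg₃ k j i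
    have q1 : 1 * L + Cψ / r * (6 * L * r) = L + 6 * (Cψ * L) := by field_simp
    have q2 : 1 * L + 2 * (Cψ / r * L) + Cψ / r ^ 2 * (6 * L * r) = L + 8 * (Cψ * L * (1 / r)) := by
      field_simp; ring
    have q3 : 1 * L + 3 * (Cψ / r * L) + 3 * (Cψ / r ^ 2 * L) + Cψ / r ^ 3 * (6 * L * r) =
        L + 3 * (Cψ * L * (1 / r)) + 9 * (Cψ * L * (1 / r ^ 2)) := by
      field_simp; ring
    have t1 : (1 + 12 * Cψ) * L = L + 12 * (Cψ * L) := by ring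
    have t2 : (1 + 12 * Cψ) * L / r = L * (1 / r) + 12 * (Cψ * L * (1 / r)) := by field_simp
    have t3 : (1 + 12 * Cψ) * L / r ^ 2 = L * (1 / r ^ 2) + 12 * (Cψ * L * (1 / r ^ 2)) := by field_simp
    have hCL : 0 ≤ Cψ * L := mul_nonneg hCψ hL
    refine ⟨e1.trans ?_, e2.trans ?_, e3.trans ?_⟩
    · rw [q1, t1]; linarith
    · rw [q2, t2]; linarith
    · rw [q3, t3]; linarith
  -- conclusion by the closure argument, derivative by derivative
  intro x i j k
  have nK : 0 ≤ (1 + 12 * Cψ) * L := by positivity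
  refine ⟨?_, ?_, ?_⟩
  · exact flatDen_abs_le_of_closure (hPs.partialDeriv i).continuous nK (fun y hy => (hin y hy i j k).1)
      (fun y hy => (hzero y hy i j k).1) x
  · exact flatDen_abs_le_of_closure ((hPs.partialDeriv j).partialDeriv i).continuous (by positivity)
      (fun y hy => (hin y hy i j k).2.1) (fun y hy => (hzero y hy i j k).2.1) x
  · exact flatDen_abs_le_of_closure (((hPs.partialDeriv k).partialDeriv j).partialDeriv i).continuous
      (by positivity) (fun y hy => (hin y hy i j k).2.2) (fun y hy => (hzero y hy i j k).2.2) x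

end Summit.AtomisticToContinuum.HydrodynamicLimit.Theorems.ConeLocalisation

end
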